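import Summits.BirchSwinnertonDyer.BirchSwinnertonDyer.Theorems.KolyvaginDepthDoorDepthTableRowKitOfPrint
import Summits.BirchSwinnertonDyer.BirchSwinnertonDyer.Theorems.KolyvaginDepthDoorKolyvaginDepthSupplyDoorNoTwistOfPrint
import HarnessLib

/-!
# Route `KolyvaginDepthDoor` — the DEPTH-TABLE ROW KIT without Kolyvagin's structure theorem AND
# WITHOUT A POINT ON THE TWIST (crux `KolyvaginDepthSupply`, stmt-BirchSwinnertonDyer-21765)

Helper file (`--supports stmt-BirchSwinnertonDyer-21765 --as helper`); it closes nothing and BSD is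
not proved by it.

`depthRow_of_print_of_intModel_certificate` (file `…DepthTableRowKitOfPrint`, g5) reads a depth-table
row off an integer model modulo the five named McCallum/Gross leaves, a compatible system of
Kolyvagin–Heegner data, the bit `c_1(ℓ) ≠ 0` AND one rational point of infinite order on the twist
`E^{(D)}` (`htw : 1 ≤ rank E^{(D)}(ℚ)`, a per-row datum the tree does not hold). This file drops
`htw`: the engine is the twist-free door `…DoorNoTwistOfPrint` (Kolyvagin's eigen-bound
`#Sel(E/K)_p^+ ≤ p²` read over `ℚ` through the injective restriction `Sel_p(E/ℚ) ↪ Sel_p(E/K)^+`,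
Literature `SelmerTorsionRestriction`, PROVED).

* `depthRow_noTwist_of_print_of_intModel_certificate` — same inputs as the g5 kit MINUS `htw`;
  OUTPUT from the bit: `corank_{ℤ_p} Ш(E/ℚ)[p^∞] = 0`, `rank_ℤ E(ℚ) = 2`, `rank_ℤ E^{(D)}(ℚ) ≤ 1`,
  `E(ℚ)[p] = 0`, `Ш(E/ℚ)[p] = 0` (every class of `Ш` killed by `p` is trivial) and
  `#Sel^(p)(E/ℚ) = p²`.

Honest comparison: the twist conclusion weakens from `rank E^{(D)} = 1 ∧ t_p(E^{(D)}) = 0` (which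
used the twist point) to `rank E^{(D)} ≤ 1`; the conclusion on `E` strengthens from `t_p(E) = 0` to
`Ш(E/ℚ)[p] = 0 ∧ E(ℚ)[p] = 0 ∧ #Sel_p(E/ℚ) = p²`. CONDITIONAL on the five named facts, the compatible
system and the bit; per-curve; BSD is not proved by it.

References: [Kolyvagin1991MathAnn] Thm. 2.3; [GrossLMS1991] §5 (5.1), §10; [McCallumLMS1991] §§2–5;
[WZhang2014] Notations (xii); [JetchevLauterStein2009] §3.6.
-/

set_option linter.dupNamespace false

noncomputable section

open scoped Classical NumberField

namespace Summit.BirchSwinnertonDyer.BirchSwinnertonDyer.Theorems.KolyvaginDepthDoor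

open Literature.NumberTheory.EllipticCurves Literature.NumberTheory.EllipticCurves.ModularForms
  Literature.NumberTheory.EllipticCurves.McCallum1991 WeierstrassCurve NumberField IsDedekindDomain

section Generic

variable {W : WeierstrassCurve ℚ} [W.IsElliptic] [W.IsGloballyMinimal] {E₀ : WeierstrassCurve ℤ}
  (hI : integralModelInt W = E₀)
include hI

/-- **The depth-table row off an integer model, without `hF` and WITHOUT A TWIST POINT.** Inputs as
in `depthRow_of_print_of_intModel_certificate` (globally minimal non-CM `W/ℚ` with integral model
`E₀`, `2 ≤ rank_ℤ E(ℚ)`, `p` odd with `ρ̄_{E,p^n}` onto for all `n`, an imaginary quadratic `K` with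
`d_K = D ∉ {−3, −4}` in which every prime of `Δ(E₀)` splits, an odd prime `ℓ ∤ Δ(E₀) D`, `ℓ ≠ p`,
`(D/ℓ) = −1`, `p ∣ ℓ + 1`, `p ∣ ℓ + 1 − #(E₀ mod ℓ)(𝔽_ℓ)`, a compatible system `d` of
Kolyvagin–Heegner data, the five named McCallum facts) EXCEPT the twist point `htw`, which is gone.
OUTPUT from the bit `(d ℓ).kolyvaginClass hp 1 ≠ 0`: `corank_{ℤ_p} Ш(E/ℚ)[p^∞] = 0`,
`rank_ℤ E(ℚ) = 2`, `rank_ℤ E^{(D)}(ℚ) ≤ 1`, `E(ℚ)[p] = 0`, `Ш(E/ℚ)[p] = 0`, `#Sel^(p)(E/ℚ) = p²`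
(`shaCorank_eq_zero_of_two_le_rank_of_kolyvaginClass_prime_ne_zero_of_print`, file
`…DoorNoTwistOfPrint`, with the row kit's `isKolyvaginPrime_of_intModel_certificate` and
`satisfiesHeegnerHypothesis_conductorNorm_of_intModel`). CONDITIONAL on the five facts; per-curve;
BSD is not proved by it. [cite: Kolyvagin1991MathAnn, Thm. 2.3] [cite: McCallumLMS1991, §§2–5]
[cite: GrossLMS1991, §5 (5.1)] [cite: WZhang2014, Notations (xii)]
[cite: JetchevLauterStein2009, §3.6 (arXiv:0707.0032)] -/
theorem depthRow_noTwist_of_print_of_intModel_certificate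
    (h54 : sign_conjAct_kolyvaginClass) (h43 : lemma43_kolyvaginClass_mem_selmerLocalKer)
    (h44 : prop44_localOrder_kolyvaginClass_mul_eq) (h53 : lemma53_selmer_eigen_dependent_at)
    (h22 : prop22_reciprocity_eigen_finset)
    (hcm : ¬ W.HasCM) (hr : 2 ≤ W.mordellWeilRank)
    (p : ℕ) [hp : Fact p.Prime] (hp2 : p ≠ 2)
    (htower : ∀ n : ℕ, W.HasSurjectiveModNGaloisRep (p ^ n : ℕ))
    (K : Type) [Field K] [NumberField K] (hK : IsImaginaryQuadratic K) {D : ℤ}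
    (hD : NumberField.discr K = D) (h3 : D ≠ -3) (h4 : D ≠ -4)
    (hH : ∀ q : ℕ, q.Prime → (q : ℤ) ∣ E₀.Δ → (q = 2 → D % 8 = 1) ∧ (q ≠ 2 → jacobiSym D q = 1))
    (ℓ : ℕ) (hℓ : ℓ.Prime) (hℓ2 : ℓ ≠ 2) (hℓΔ : ¬ (ℓ : ℤ) ∣ E₀.Δ) (hℓD : ¬ (ℓ : ℤ) ∣ D)
    (hℓp : ℓ ≠ p) (hjac : jacobiSym D ℓ = -1) (hℓ1 : p ∣ ℓ + 1) {n : ℕ}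
    (hcard : Nat.card ((E₀.map (Int.castRingHom (ZMod ℓ))).toAffine.Point) = n)
    (haℓ : (p : ℤ) ∣ (ℓ : ℤ) + 1 - n)
    [NeZero (W.conductorNorm ℤ)] (Dt : ModularParametrizationData W (W.conductorNorm ℤ)) (β : ℤ)
    (ι : K →+* ℂ) (d : ∀ m : ℕ, KolyvaginHeegnerData Dt β ι m)
    (hσ : ∀ (m l : ℕ), ∀ l' ∈ m.primeFactors, ∀ (x : ringClassField K ι m)
      (x' : ringClassField K ι (m * l)),
      (x : ℂ) = x' → (((d (m * l)).σ l' x' : ringClassField K ι (m * l)) : ℂ) = ((d m).σ l' x : ℂ))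
    (hS₁ : ∀ (m l : ℕ), ∀ s ∈ (d m).S, ∃ s' ∈ (d (m * l)).S, ∀ (x : ringClassField K ι m)
      (x' : ringClassField K ι (m * l)),
      (x : ℂ) = x' → ((s' x' : ringClassField K ι (m * l)) : ℂ) = (s x : ℂ))
    (hS₂ : ∀ (m l : ℕ), ∀ s' ∈ (d (m * l)).S, ∃ s ∈ (d m).S, ∀ (x : ringClassField K ι m)
      (x' : ringClassField K ι (m * l)),
      (x : ℂ) = x' → ((s' x' : ringClassField K ι (m * l)) : ℂ) = (s x : ℂ))
    (hemb : ∀ (m l : ℕ) (x : ringClassField K ι m) (x' : ringClassField K ι (m * l)),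
      (x : ℂ) = x' → (d (m * l)).emb x' = (d m).emb x)
    (hne : (d ℓ).kolyvaginClass hp.out 1 ≠ 0) :
    W.shaCorank p = 0 ∧ W.mordellWeilRank = 2 ∧ (W.quadraticTwist (D : ℚ)).mordellWeilRank ≤ 1 ∧
      (∀ P : W.toAffine.Point, p • P = 0 → P = 0) ∧ (∀ c ∈ W.sha, p • c = 0 → c = 0) ∧
      Nat.card ↥(selmerGroup W (p : ℤ)) = p ^ 2 := by
  obtain ⟨hkol, -⟩ := isKolyvaginPrime_of_intModel_certificate hI p K hK.1 hD ℓ hℓ hℓ2 hℓΔ hℓD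
    hℓp hjac hℓ1 hcard haℓ
  obtain ⟨c, hc, hcc⟩ := exists_conj_of_isImaginaryQuadratic K hK
  have hH' := satisfiesHeegnerHypothesis_conductorNorm_of_intModel hI K hK.1 hD hH
  obtain ⟨hsha, hr, hr', ht, hbot, hSel⟩ :=
    shaCorank_eq_zero_of_two_le_rank_of_kolyvaginClass_prime_ne_zero_of_print h54 h43 h44 h53 h22
      hcm hK (by rw [hD]; exact h3) (by rw [hD]; exact h4) hH' p hp2 htower c hc hcc d hσ hS₁ hS₂
      hemb hkol hne hr
  rw [pow_one] at ht hbot hSel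
  rw [hD] at hr'
  refine ⟨hsha, hr, hr', fun P hP ↦ ?_, fun x hx hpx ↦ ?_, hSel⟩
  · have hmem : P ∈ AddSubgroup.torsionBy W.toAffine.Point (p : ℤ) :=
      AddSubgroup.torsionBy.nsmul_iff.mpr hP
    rw [AddSubgroup.card_eq_one.mp ht] at hmem
    exact (AddSubgroup.mem_bot).mp hmem
  · have hmem : x ∈ W.sha ⊓ AddSubgroup.torsionBy W.galH1 (p : ℤ) :=
      AddSubgroup.mem_inf.mpr ⟨hx, AddSubgroup.torsionBy.nsmul_iff.mpr hpx⟩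
    rw [hbot] at hmem
    exact (AddSubgroup.mem_bot).mp hmem

end Generic

end Summit.BirchSwinnertonDyer.BirchSwinnertonDyer.Theorems.KolyvaginDepthDoor

end
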